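import Literature.Probability.RandomPlanarGeometry.LoewnerShiftAtContact
import Literature.Probability.RandomPlanarGeometry.LoewnerImageTip
import HarnessLib

/-!
# The alive image-chain API at the empty hull

Topic `Probability/RandomPlanarGeometry`; theorems only (crux `stmt-CriticalPhenomena-0698`, stub
`stub_isLocal`, through-swallow image chain of the locality of SLE₆: G. F. Lawler (2005), §6.3
Thm. 6.13; Lawler–Schramm–Werner (2003), §5). When the closed Loewner hull has swallowed ALL of the
`*`-hull `A`, the remaining hull `A ∖ K̂_t` (`Loewner.remHull`) is empty and the through-swallow
objects of `LoewnerRemainingHull.lean` are the PLAIN chain shifted by the constant `L_A`: the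
canonical map of the empty hull is the identity (`starMap_empty_apply`), `L_∅ = 0` (`starShift_empty`)
and `d_∅ = Φ_∅'(0) = 1` (`starDeriv_empty`). The alive theory (`LoewnerImageFlow*`,
`RestrictionDerivTime`) is stated for NONEMPTY `*`-hulls; here we record the empty case and the
wrappers `…'` valid for every `*`-hull, empty or not:

* `imageDriver_empty : imageDriver W ∅ t = W t`, `imageFlow_empty : imageFlow W ∅ t z = g_t z`,
  `imageClockRate_empty : imageClockRate W ∅ r = 1`;
* `continuousAt_map_apply`, `hasDerivAt_map_toNNReal` — continuity and the Loewner equation of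
  `t ↦ g_t z` for an alive point (from the maximal solution, `map_eq_of_isSolution`);
* `continuousWithinAt_imageDriver'`, `continuousWithinAt_imageFlow'`,
  `continuousWithinAt_starDeriv_slidHull'`, `hasDerivAt_imageFlow'` — the alive API for a possibly
  empty `*`-hull (`Im (g̃_t(ζ) − W̃_t) > 0` needs no wrapper: `im_imageFlow_sub_imageDriver_pos` of
  `LoewnerImageFlowContinuity.lean` already holds for every `*`-hull, empty or not);
* `map_sub_driving_mem_diff_slidHull` — the slid point `g_t z − W_t` of `z ∈ ℍ ∖ B` alive at the
  alive time `t` lies in `ℍ ∖ B_t`.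
-/

noncomputable section

open Set Filter Topology Function Complex Metric
open UpperHalfPlane (upperHalfPlaneSet)
open scoped NNReal

namespace Literature.Probability.RandomPlanarGeometry

/-- **`d_∅ = Φ_∅'(0) = 1`**: the canonical map of the empty hull is the identity. [folklore] -/
theorem starDeriv_empty : starDeriv (∅ : Set ℂ) = 1 := by
  have h := deriv_starMap_zero isStarHull_empty
  have hE : starMap (∅ : Set ℂ) = id := funext starMap_empty_apply
  rw [hE, deriv_id] at h
  exact_mod_cast h.symm

namespace Loewner

variable {W : ℝ≥0 → ℝ}

/-! ### The image objects of the empty hull -/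

/-- `W̃_t = W_t` for the empty hull. [folklore] -/
theorem imageDriver_empty (t : ℝ≥0) : imageDriver W ∅ t = W t := by
  rw [imageDriver, slidHull_empty, starShift_empty, Complex.zero_re]; ring

/-- `g̃_t(z) = g_t(z)` for the empty hull. [folklore] -/
theorem imageFlow_empty (t : ℝ≥0) (z : ℂ) : imageFlow W ∅ t z = map W t z := by
  rw [imageFlow, slidHull_empty, starShift_empty, starMap_empty_apply]; ring

/-- `d_r² = 1` for the empty hull. [folklore] -/
theorem imageClockRate_empty (r : ℝ) : imageClockRate W ∅ r = 1 := by
  rw [imageClockRate, slidHull_empty, starDeriv_empty, one_pow]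

/-! ### The plain flow of an alive point -/

/-- `u ↦ g_u(z)` is continuous at every time `s < T_z`. [folklore] -/
theorem continuousAt_map_apply (hW : Continuous W) {z : ℂ} {s : ℝ≥0}
    (hz : (s : WithTop ℝ≥0) < swallowingTime W z) : ContinuousAt (fun u : ℝ≥0 ↦ map W u z) s := by
  obtain ⟨t₀, hst₀, -, ht₀⟩ := exists_horizon (β := s + 1) hz (lt_add_one s)
  exact (continuousOn_map_apply hW ht₀).continuousAt (Iic_mem_nhds hst₀)

/-- **The Loewner equation of `t ↦ g_t(z)` read at `t.toNNReal`**: `∂_t g_t(z) = 2/(g_t z − W_t)` at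
every `s ∈ (0, β)` for `z` alive at `β`. [cite: Lawler2005, Ch. 4 §4.1 (4.4)] -/
theorem hasDerivAt_map_toNNReal (hW : Continuous W) {z : ℂ} {β : ℝ≥0}
    (hzβ : (β : WithTop ℝ≥0) < swallowingTime W z) {s : ℝ} (hs0 : 0 < s) (hsβ : s < β) :
    HasDerivAt (fun t : ℝ ↦ map W t.toNNReal z) (2 / (map W s.toNNReal z - W s.toNNReal)) s := by
  obtain ⟨g, hg⟩ := exists_isSolution_swallowingTime_holds hW (ne_driving_of_lt_swallowingTime hzβ)
  have hlt : ∀ {t : ℝ}, t < β → ((t.toNNReal : ℝ≥0) : WithTop ℝ≥0) < swallowingTime W z := fun ht ↦ by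
    refine lt_of_le_of_lt (WithTop.coe_le_coe.2 ?_) hzβ
    exact Real.toNNReal_le_iff_le_coe.2 ht.le
  have h1 : HasDerivAt g (vectorField W s (g s)) s := hg.hasDerivAt hs0 (hlt hsβ)
  have hgs : g s = map W s.toNNReal z := by
    rw [map_eq_of_isSolution hW hg (hlt hsβ), Real.coe_toNNReal s hs0.le]
  rw [vectorField_apply, hgs] at h1
  refine h1.congr_of_eventuallyEq ?_
  filter_upwards [Ioo_mem_nhds hs0 hsβ] with t ht
  rw [map_eq_of_isSolution hW hg (hlt ht.2), Real.coe_toNNReal t ht.1.le]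

/-! ### The alive API for a possibly empty `*`-hull -/

variable {B : Set ℂ}

/-- `t ↦ W̃_t` is continuous within the alive times (any `*`-hull, possibly empty).
[cite: LawlerSchrammWerner2003Restriction, §5 (W̃_t continuous)] -/
theorem continuousWithinAt_imageDriver' (hW : Continuous W) (hB : IsStarHull B) {s : ℝ≥0}
    (hs : Disjoint (closedHull W s) B) :
    ContinuousWithinAt (fun v : ℝ≥0 ↦ imageDriver W B v) {v | Disjoint (closedHull W v) B} s := by
  rcases B.eq_empty_or_nonempty with rfl | hne
  · simp_rw [imageDriver_empty]
    exact hW.continuousWithinAt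
  · exact continuousWithinAt_imageDriver hW hB hne hs

/-- `t ↦ g̃_t(ζ)` is continuous within the alive times (any `*`-hull, possibly empty).
[cite: LawlerSchrammWerner2003Restriction, §5 (g̃_t)] -/
theorem continuousWithinAt_imageFlow' (hW : Continuous W) (hB : IsStarHull B) {s : ℝ≥0}
    (hs : Disjoint (closedHull W s) B) {z : ℂ} (hzH : 0 < z.im) (hzB : z ∉ B)
    (hz : (s : WithTop ℝ≥0) < swallowingTime W z) :
    ContinuousWithinAt (fun v : ℝ≥0 ↦ imageFlow W B v z) {v | Disjoint (closedHull W v) B} s := by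
  rcases B.eq_empty_or_nonempty with rfl | hne
  · simp_rw [imageFlow_empty]
    exact (continuousAt_map_apply hW hz).continuousWithinAt
  · exact continuousWithinAt_imageFlow hW hB hne hs hzH hzB hz

/-- `t ↦ d_t = Φ'_{B_t}(0)` is continuous within the alive times (any `*`-hull, possibly empty).
[cite: LawlerSchrammWerner2003Restriction, §5 (h_t'(W_t) continuous in t)] -/
theorem continuousWithinAt_starDeriv_slidHull' (hW : Continuous W) (hB : IsStarHull B) {s : ℝ≥0}
    (hs : Disjoint (closedHull W s) B) :
    ContinuousWithinAt (fun v : ℝ≥0 ↦ starDeriv (slidHull W B v)) {v | Disjoint (closedHull W v) B} s := by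
  rcases B.eq_empty_or_nonempty with rfl | hne
  · simp_rw [slidHull_empty]
    exact continuousWithinAt_const
  · exact continuousWithinAt_starDeriv_slidHull hW hB hne hs

/-- **[LSW] (5.1) as a two-sided derivative, any `*`-hull (possibly empty)**:
`∂_t g̃_t(ζ) = 2 d_t²/(g̃_t(ζ) − W̃_t)` at every `s ∈ (0, β)`, `β` alive, `z ∈ ℍ ∖ B` alive at `β`.
[cite: LawlerSchrammWerner2003Restriction, §5 (5.1); Lawler2005, Prop. 4.40 and (4.34)] -/
theorem hasDerivAt_imageFlow' (hW : Continuous W) (hB : IsStarHull B) {β : ℝ≥0}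
    (hβ : Disjoint (closedHull W β) B) {z : ℂ} (hzH : 0 < z.im) (hzB : z ∉ B)
    (hzβ : (β : WithTop ℝ≥0) < swallowingTime W z) {s : ℝ} (hs0 : 0 < s) (hsβ : s < β) :
    HasDerivAt (fun t : ℝ ↦ imageFlow W B t.toNNReal z)
      (2 * (starDeriv (slidHull W B s.toNNReal) : ℂ) ^ 2 /
        (imageFlow W B s.toNNReal z - imageDriver W B s.toNNReal)) s := by
  rcases B.eq_empty_or_nonempty with rfl | hne
  · simp_rw [imageFlow_empty]
    rw [imageDriver_empty, slidHull_empty, starDeriv_empty]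
    push_cast
    rw [one_pow, mul_one]
    exact hasDerivAt_map_toNNReal hW hzβ hs0 hsβ
  · exact hasDerivAt_imageFlow hW hB hne hβ hzH hzB hzβ hs0 hsβ

/-! ### The slid point lies off the slid hull -/

/-- **The slid point `g_t z − W_t` of `z ∈ ℍ ∖ B` (alive at the alive time `t`) lies in `ℍ ∖ B_t`**
(`g_t` is injective on `H_t` and real on the alive real points). [folklore] -/
theorem map_sub_driving_mem_diff_slidHull (hW : Continuous W) (hB : IsStarHull B) {t : ℝ≥0}
    (ht : Disjoint (closedHull W t) B) {z : ℂ} (hzH : 0 < z.im) (hzB : z ∉ B)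
    (hz : (t : WithTop ℝ≥0) < swallowingTime W z) :
    map W t z - W t ∈ upperHalfPlaneSet \ slidHull W B t := by
  have hzdom : z ∈ domain W t := (mem_domain_iff W t z).2 ⟨hzH, hz⟩
  refine ⟨?_, ?_⟩
  · show 0 < (map W t z - W t).im
    rw [sub_im, ofReal_im, sub_zero]; exact mapsTo_map hW t hzdom
  · rintro ⟨a, ha, hae⟩
    have haalive := lt_swallowingTime_of_alive hB ht ha
    have heq : map W t a = map W t z := by
      have := congrArg (· + (W t : ℂ)) hae; simpa using this
    have haim : 0 ≤ a.im := hB.isBoundedHull.im_nonneg ha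
    rcases haim.lt_or_eq with hapos | hazero
    · have hadom : a ∈ domain W t := (mem_domain_iff W t a).2 ⟨hapos, haalive⟩
      exact hzB ((injOn_map hW t hadom hzdom heq) ▸ ha)
    · have ha' : a = (((a.re : ℝ)) : ℂ) := Complex.ext rfl (by rw [ofReal_im]; exact hazero.symm)
      rw [ha'] at haalive heq
      have hreal : (map W t (a.re : ℝ)).im = 0 := map_ofReal_im hW haalive
      rw [heq] at hreal
      exact absurd hreal (ne_of_gt (mapsTo_map hW t hzdom))

end Loewner

end Literature.Probability.RandomPlanarGeometry

end
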